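import Literature.AlgebraicGeometry.Resolution.HironakaGroupSchemeMultiplicity
import Literature.RingTheory.HilbertSamuel.ProjDirectrixChart
import Literature.AlgebraicGeometry.CossartJannsenSaito2020.KeyTheorems
import HarnessLib

/-!
# Hironaka 1970 (J. Math. Kyoto Univ. 10), THEOREM IV — for a POINT blow-up: at a near point the tangent
# cone is invariant under the Hironaka group of the point, i.e. its ideal is generated by elements of
# `U_{g,x'}` — STATEMENT ONLY (fact F-51 of cell res-hironaka, crux chain w42, T7)

Source: H. Hironaka, *Certain numerical characters of singularities*, J. Math. Kyoto Univ. 10 (1970)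
151–187 [`Hironaka1970NumericalCharacters`], held text `paper:hironaka1970-certain-numerical-characters-singularities`
(PDF page `k` = printed p. `150 + k`; OCR). Read on the page:

> (p. 155 L23–33, the standing data (2.1)–(2.2)) «let us consider `x ∈ D ⊂ X ⊂ Z`, where `Z` is a regular
> scheme, `X` a closed subscheme of `Z` and `D` a closed regular subscheme of `X` such that (2.1) `X` is
> normally flat along `D` at the point `x`. Our basic geometric object then is the following [diagram
> (2.2): `x' ∈ X' ⊂ Z'` over `x ∈ X ⊂ Z`] where `g` (resp. `f`) is the blowing-up with center `D`, … and
> `x'` is any point of `f⁻¹(x)`.»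
> (p. 156 L11–12) «**THEOREM IV.** If the equality of TH III holds, then the tangential cone `C_{X,x}` is
> invariant by the subgroup `B_{g,x'}` of `T_{Z,x}`.» (TH III, p. 156 L7–10: `ν*_{x'}(X',Z') = ν*_x(X,Z)`
> iff `H^{(1+d)}_{X',x'} = H^{(1)}_{X,x}`, `d = tr.deg_{k(x)} k(x')` — the «near» condition; = CJS LNM 2270
> Thm. 3.10 (2)+(6) p. 47 and Def. 3.13 (1) p. 50 «`x'` is near to `x` if `H_{X'}(x') = H_X(x)`».)
> (p. 154 L24–29; p. 168 (13.1) L22–31) «choose a regular system of parameters of `𝒪_{Z,x}`, say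
> `(x_0, x_1, …, x_r, y_1, …, y_s)` such that `(x_0, …, x_r)𝒪_{Z,x} = I_{Z,D,x}` and
> `(x_0)𝒪_{Z',x'} = I_{Z,D,x}𝒪_{Z',x'}` … `U_{g,x'}` is then the graded `K`-subalgebra of the polynomial
> ring `K[X]` whose homogeneous part of degree `d` is `{φ ∈ K[X]_d | ν_{x'}(φ/X_0^d) ≥ d}`, where `g⁻¹(x)`
> is identified with `Proj(K[X])` and `x'` is viewed as a point of `Proj(K[X])`.»
> (p. 170 L3–9) «By definition, `C_{X,x}` is invariant by `B_{g,x'}` if and only if the ideal of `C_{X,x}`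
> in `gr_x(Z)` is generated by elements of `U_{g,x'}`. By the normal flatness assumption (2.1), the ideal
> of `C_{X,x}` in `gr_x(Z)` is generated by the ideal of `C_{X,D,x}` in `gr_x(Z,D) = K[X]`. It follows
> that (14.3) `C_{X,x}` is invariant by `B_{g,x'}` if and only if there exists a standard base of the
> ideal `I` consisting of elements in `U_{g,x'}`.»

## What is typed — the POINT-CENTRE case `D = {x}` (cell res-hironaka W4.2 consumer shape, companion of
## `CossartJannsenSaito2020.Thm314_point_locus`)

For `D = {x}` (a closed point whose reduced subscheme is permissible; normal flatness along a point is
automatic) one has `C_{X,D,x} = C_{X,x}`, `gr_x(Z,D) = gr_x(Z)`, `T_{D,x} = 0` and `B_{g,x'} = B_{P,x'}`,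
the Hironaka group of the point `x'` of the exceptional projective space. RENDERING CHOICES (to be read
with the statement):

(a) The regular ambient `Z` of (2.2) is taken of dimension `emb.dim_x(X)` through the local ring: the
polynomial ring `K[X] = gr_x(Z)` is `Sym_{k(x)}(𝔪_x/𝔪_x²) = k(x)[X_1, …, X_e]` on a minimal system of
generators `x_1, …, x_e` of `𝔪_x` (a minimal Cohen presentation of `𝒪̂_{X,x}` [folklore]; CJS p. 48 L18 and
p. 107 L3: «by Lemmas 2.27 and 2.37 we may assume that `X = Spec(𝒪)` for a complete local ring … an embedding
`X ↪ Z` into a regular excellent scheme»; CJS apply [H4, Th. IV] in exactly this reading in the proof of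
Thm. 3.14, p. 51 L17 – p. 52 L1), so that `g⁻¹(x) = ℙ(T_x(X)) ⊇ π⁻¹(x) = ℙ(C_x(X))` and the cone ideal is the
tree's `tangentConeIdeal`;
(†) «`X` closed in a regular `Z`» is replaced by the tree's standing hypothesis `Scheme.IsExcellent X` (as in
`Thm314_point_locus`); the THEOREM itself has no characteristic and no residue-field hypothesis.
(b) «The equality of TH III» is typed as CJS's «near»: `H^N_{X'}(x') = H^N_X(x)` for the tree's
`Scheme.hsFun · N`, `N ≥ dim X` (CJS Thm. 3.10 (2)+(6) identify it with Hironaka's `ν*`-equality; the held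
OCR of TH III's display is garbled and was read through CJS).
(c) The conclusion is p. 170 L3–4's «the ideal of `C_{X,x}` is generated by elements of `U_{g,x'}`» (the
printed EQUIVALENT of invariance «by definition»), not (14.3)'s standard-base form; `U_{g,x'}` is the
multiplicity algebra `HironakaScheme.multAlgebra` (Mizutani's `U(𝔭)`, `HironakaGroupSchemeMultiplicity.lean`)
of the homogeneous prime `𝔭_{x'} = chartPrime` of the point `x'` (`ProjDirectrixChart.lean`), in a chart
`(t, u)` of the exceptional divisor at `x'`: `𝔪_x𝒪_{X',x'} = (t)`, `t` a non-zero-divisor, `π^♯(x_i) = u_i t`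
(Hironaka normalises `t = π^♯(x_0)`; any local equation gives the same `𝔭_{x'}`). NO additive group scheme
is typed (none is needed for this sentence of the source).

Statement only (`def … : Prop`); consumers take `(h : Hironaka1970_thmIV_point)`. NOT a statement of
H. Hironaka's 2017 manuscript; a theorem of the refereed 1970 paper, typed as fact F-51 of cell
res-hironaka's fact desk (reserved 2026-08-27T05:41:39Z) for the OURS theorem 2.14♯
(`directrix_nearPoint_of_geomDirDim_le`). AI-typed; AI review is weaker than expert review.
-- TODO(general form): arbitrary permissible centre `D ∋ x` (normal cone `C_{X,D,x} ⊂ N_{Z,D,x}`,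
`B_{g,x'} ⊇ T_{D,x}`), and the standard-base form (14.3).

## References

* H. Hironaka, J. Math. Kyoto Univ. 10 (1970): (2.1)–(2.2) p. 155, TH III–IV p. 156, p. 154 L24–29,
  (13.1)–(13.2) p. 168, (14.3) p. 170. [Hironaka1970NumericalCharacters]
* V. Cossart, U. Jannsen, S. Saito, LNM 2270 (2020): Thm. 3.10 (2)(6) p. 47, Def. 3.13 (1) p. 50, Thm. 3.14
  proof p. 52 L1 («the action of `B_{P,x'}` on `V` respects `C_x(X)/T_x(D)` if `x'` is near to `x`»),
  p. 107 L3. [CossartJannsenSaito2020]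
-/

noncomputable section

open CategoryTheory AlgebraicGeometry TopologicalSpace IsLocalRing
open Literature.RingTheory.HilbertSamuel

namespace Literature.AlgebraicGeometry.Resolution

universe u

/-- NAMED FACT — **Hironaka 1970 (Kyoto), THEOREM IV (p. 156 L11–12) for the blow-up of a closed point,
in the form p. 170 L3–4**: «If the equality of TH III holds [`x'` near to `x`: `H_{X'}(x') = H_X(x)`], then
the tangential cone `C_{X,x}` is invariant by the subgroup `B_{g,x'}` of `T_{Z,x}`», where «by definition,
`C_{X,x}` is invariant by `B_{g,x'}` if and only if the ideal of `C_{X,x}` in `gr_x(Z)` is generated by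
elements of `U_{g,x'}`», `U_{g,x'} = {φ ∈ K[X]_d | ν_{x'}(φ/X_0^d) ≥ d}_d` (p. 168 L28–31). Typed (module
docstring (a)–(c)): for `X` locally noetherian and excellent, `x` a closed point with `{x}` permissible,
`π : X' ⟶ X` a blow-up in `{x}`, `N ≥ dim X`, `x'` over `x` with `H^N_{X'}(x') = H^N_X(x)`; for every
minimal system of generators `g_1, …, g_e` of `𝔪_x` (`e = emb.dim`) and every chart `(t, u)` of the
exceptional divisor at `x'` (`t` a non-zero-divisor of `𝒪_{X',x'}` with `𝔪_x 𝒪_{X',x'} = (t)` and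
`π^♯(g_i) = u_i t`): the tangent-cone ideal `J ⊆ k(x)[X_1, …, X_e]` of `𝒪_{X,x}` is generated by its
elements lying in the algebra `U(𝔭_{x'})` of the homogeneous prime `𝔭_{x'}` of the point `x'` of
`ℙ(T_x X)`. Statement only; users take `(h : Hironaka1970_thmIV_point)`.
[cite: Hironaka1970NumericalCharacters, THEOREM IV p. 156 L11–12; p. 170 L3–9 (14.3); (2.1)–(2.2) p. 155 L23–33; p. 154 L24–29; (13.1)–(13.2) p. 168; CossartJannsenSaito2020, Thm. 3.10 (2)(6) p. 47, Def. 3.13 (1) p. 50, proof of Thm. 3.14 p. 51 L17 – p. 52 L1, p. 48 L18] -/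
def Hironaka1970_thmIV_point : Prop :=
  ∀ (X X' : Scheme.{u}) [IsLocallyNoetherian X] (π : X' ⟶ X) (x : X) (hx : IsClosed ({x} : Set X))
    (N : ℕ) (x' : X'),
    Scheme.IsExcellent X →
    IdealSheafData.IsPermissible (Scheme.IdealSheafData.vanishingIdeal ⟨{x}, hx⟩) →
    IsBlowup π (Scheme.IdealSheafData.vanishingIdeal ⟨{x}, hx⟩) →
    topologicalKrullDim ↥X ≤ (N : WithBot ℕ∞) → π.base x' = x →
    Scheme.hsFun X' N x' = Scheme.hsFun X N x →
    ∀ (e : ℕ) (g : Fin e → X.presheaf.stalk (π.base x'))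
      (hg : Ideal.span (Set.range g) = maximalIdeal (X.presheaf.stalk (π.base x')))
      (t : X'.presheaf.stalk x') (u : Fin e → X'.presheaf.stalk x'),
      (maximalIdeal (X.presheaf.stalk (π.base x'))).spanFinrank = e →
      t ∈ nonZeroDivisors (X'.presheaf.stalk x') →
      (maximalIdeal (X.presheaf.stalk (π.base x'))).map (π.stalkMap x').hom = Ideal.span {t} →
      (∀ i, (π.stalkMap x').hom (g i) = u i * t) →
        tangentConeIdeal g hg ≤ Ideal.span
          ((tangentConeIdeal g hg : Set (MvPolynomial (Fin e) (ResidueField (X.presheaf.stalk (π.base x'))))) ∩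
            (HironakaScheme.multAlgebra (ResidueField (X.presheaf.stalk (π.base x')))
              (chartPrime (π.stalkMap x').hom u) :
              Set (MvPolynomial (Fin e) (ResidueField (X.presheaf.stalk (π.base x'))))))

end Literature.AlgebraicGeometry.Resolution

end
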